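import Mathlib.AlgebraicGeometry.Morphisms.Proper
import HarnessLib

/-!
# A proper open piece of an irreducible scheme is everything: the clopen argument

Topic: `Literature/AlgebraicGeometry/Morphisms`. Elementary glue on Mathlib's scheme library used
when an open piece `Y` of an irreducible scheme `Z` over a base `X` is known to be PROPER over an
open `U ⊆ X` (e.g. `Z` = the closure of `Y` in a compactification over `X`): then `Y` is exactly
the part of `Z` over `U`, i.e. the square `Y → Z`, `Y → U`, `Z → X`, `U ↪ X` is cartesian. The
mechanism is the classical "open + proper ⇒ clopen ⇒ everything": a universally closed morphism
has closed image, universal closedness cancels along a separated morphism (Stacks, Tag 01W6),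
and a non-empty clopen subset of an irreducible space is the whole space.

* `isIso_of_isOpenImmersion_of_universallyClosed` — a universally closed open immersion with
  non-empty source into a preirreducible scheme is an isomorphism;
* `isIso_of_isOpenImmersion_of_universallyClosed_comp` — the same when only `i ≫ h` is
  universally closed for some separated `h`;
* `isPullback_of_isOpenImmersion_of_universallyClosed` — **the cartesian square**: for an open
  immersion `s : Y → Z` into a preirreducible `Z`, a separated `ρ : Z → X`, an open immersion
  `j : V → X` and a universally closed `g : Y → V` with `s ≫ ρ = g ≫ j` and `Y ≠ ∅`, the square
  is cartesian (`Y ≅ Z ×_X V`);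
* `isIso_morphismRestrict_image_of_isPullback` — in a cartesian square `Y = Z ×_X U` over an
  open `U ⊆ X`, if `g : Y → U` is an isomorphism over `O ⊆ U` then `ρ : Z → X` is an isomorphism
  over `O ⊆ X`.

## References

* The Stacks Project, Tag 01W6 (cancellation for universally closed and proper morphisms).
  [StacksProject]
-/

noncomputable section

open CategoryTheory CategoryTheory.Limits AlgebraicGeometry TopologicalSpace Topology

namespace Literature.AlgebraicGeometry.Morphisms

universe u

/-- **A universally closed open immersion with non-empty source into a preirreducible scheme is
an isomorphism**: its range is a non-empty clopen subset of a preconnected space. [folklore] -/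
theorem isIso_of_isOpenImmersion_of_universallyClosed {Z T : Scheme.{u}} (i : Z ⟶ T)
    [IsOpenImmersion i] [UniversallyClosed i] [PreirreducibleSpace T] [Nonempty Z] : IsIso i := by
  apply isIso_of_isOpenImmersion_of_opensRange_eq_top
  have hclopen : IsClopen (Set.range i) :=
    ⟨i.isClosedMap.isClosed_range, i.isOpenEmbedding.isOpen_range⟩
  have huniv : Set.range i = Set.univ := hclopen.eq_univ (Set.range_nonempty _)
  ext1
  rw [Scheme.Hom.coe_opensRange, Opens.coe_top, huniv]

/-- **The clopen argument**: an open immersion `i : Z → T` with non-empty source into a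
preirreducible scheme `T` such that `i ≫ h` is universally closed for some separated `h : T → B`
is an isomorphism (`i` is then universally closed, Stacks 01W6). [cite: StacksProject, Tag 01W6] -/
theorem isIso_of_isOpenImmersion_of_universallyClosed_comp {Z T B : Scheme.{u}} (i : Z ⟶ T)
    [IsOpenImmersion i] (h : T ⟶ B) [IsSeparated h] [UniversallyClosed (i ≫ h)]
    [PreirreducibleSpace T] [Nonempty Z] : IsIso i :=
  haveI : UniversallyClosed i := .of_comp_of_isSeparated i h
  isIso_of_isOpenImmersion_of_universallyClosed i

/-- **A proper open piece over an open of the base is the whole preimage.** Let `s : Y → Z` be an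
open immersion into a preirreducible scheme `Z`, `ρ : Z → X` separated, `j : V → X` an open
immersion and `g : Y → V` universally closed (e.g. proper) with `s ≫ ρ = g ≫ j` and `Y`
non-empty. Then the square is cartesian: `Y ≅ Z ×_X V`. Indeed the comparison map
`t : Y → Z ×_X V` is an open immersion (`t ≫ pr₁ = s`) which is universally closed
(`t ≫ pr₂ = g`, `pr₂` separated), and `Z ×_X V` is a non-empty open piece of `Z`, hence
preirreducible, so `t` is an isomorphism. [folklore] -/
theorem isPullback_of_isOpenImmersion_of_universallyClosed {Y Z V X : Scheme.{u}} (s : Y ⟶ Z)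
    [IsOpenImmersion s] (g : Y ⟶ V) [UniversallyClosed g] (ρ : Z ⟶ X) [IsSeparated ρ]
    (j : V ⟶ X) [IsOpenImmersion j] [PreirreducibleSpace Z] [Nonempty Y]
    (h : s ≫ ρ = g ≫ j) : IsPullback s g ρ j := by
  let t : Y ⟶ pullback ρ j := pullback.lift s g h
  have ht₁ : t ≫ pullback.fst ρ j = s := pullback.lift_fst _ _ _
  have ht₂ : t ≫ pullback.snd ρ j = g := pullback.lift_snd _ _ _
  haveI : IsOpenImmersion t := by
    haveI : IsOpenImmersion (t ≫ pullback.fst ρ j) := by rw [ht₁]; infer_instance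
    exact IsOpenImmersion.of_comp t (pullback.fst ρ j)
  haveI : UniversallyClosed (t ≫ pullback.snd ρ j) := by rw [ht₂]; infer_instance
  haveI : Nonempty ↑(pullback ρ j) := ⟨t (Classical.arbitrary Y)⟩
  haveI : PreirreducibleSpace ↑(pullback ρ j) :=
    (pullback.fst ρ j).isOpenEmbedding.preirreducibleSpace
  haveI : IsIso t := isIso_of_isOpenImmersion_of_universallyClosed_comp t (pullback.snd ρ j)
  exact IsPullback.of_iso_pullback ⟨h⟩ (asIso t) ht₁ ht₂

/-- **The iso-locus passes from the piece to the extension.** In a cartesian square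
`Y ≅ Z ×_X U` (`IsPullback s g ρ U.ι`, `U ⊆ X` open), if `g : Y → U` is an isomorphism over the
open `O ⊆ U` then `ρ : Z → X` is an isomorphism over `O ⊆ X`: both `g` and `ρ ∣_ U` are base
changes of `ρ` along `U ↪ X`, so `g = e ≫ ρ ∣_ U` for an isomorphism `e`, and
`ρ ∣_ U ∣_ O ≅ ρ ∣_ O`. [folklore] -/
theorem isIso_morphismRestrict_image_of_isPullback {Y Z X : Scheme.{u}} {U : X.Opens} {s : Y ⟶ Z}
    {g : Y ⟶ (U : Scheme.{u})} {ρ : Z ⟶ X} (H : IsPullback s g ρ U.ι) (O : (U : Scheme.{u}).Opens)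
    [IsIso (g ∣_ O)] : IsIso (ρ ∣_ (U.ι ''ᵁ O)) := by
  have H' : IsPullback (ρ ⁻¹ᵁ U).ι (ρ ∣_ U) ρ U.ι := (isPullback_morphismRestrict ρ U).flip
  let e : Y ≅ (ρ ⁻¹ᵁ U : Scheme.{u}) := H.isoIsPullback _ _ H'
  have he : e.hom ≫ (ρ ∣_ U) = g := H.isoIsPullback_hom_snd _ _ H'
  have h0 : IsIso (e.hom ∣_ ((ρ ∣_ U) ⁻¹ᵁ O)) := inferInstance
  have h1 : IsIso ((e.hom ≫ (ρ ∣_ U)) ∣_ O) := by rw [he]; infer_instance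
  rw [morphismRestrict_comp] at h1
  have h2 : IsIso (ρ ∣_ U ∣_ O) := @IsIso.of_isIso_comp_left _ _ _ _ _ _ _ h0 h1
  exact ((MorphismProperty.isomorphisms Scheme).arrow_mk_iso_iff
    (morphismRestrictRestrict ρ U O)).mp h2

/-- The image in `X` of a non-empty open of an open `U ⊆ X` is non-empty. [folklore] -/
theorem nonempty_image_ι {X : Scheme.{u}} (U : X.Opens)
    {O : (U : Scheme.{u}).Opens} (hO : (O : Set (U : Scheme.{u})).Nonempty) :
    (U.ι ''ᵁ O : Set X).Nonempty := by
  obtain ⟨x, hx⟩ := hO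
  exact ⟨U.ι x, ⟨x, hx, rfl⟩⟩

end Literature.AlgebraicGeometry.Morphisms

end
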